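import Summits.Ventures.AbcSig.Rows.Bridge
import Summits.Ventures.AbcSig.Rows.C2aL157A6S
import Summits.Ventures.AbcSig.Rows.C2aL157A6SAB

/-!
# Venture AbcSig — CELL `C2aL157A6`: the census statement `Rows.C2aCellRed 157 (fun a => 6 ≤ a) ∅` from the two row theorems

S-VARIANT (p-lean g5) of `xcell_C2aL157A6`: kernel sieve discharges replace the cited pair(s) 314.2 @ 13 (see the row files).
HONEST FRAMING. COMPUTATION cell `pub-abcsig`; CONDITIONAL theorem; no claim on ABC or any summit. Hypotheses exactly as
in `Rows/C2aL157A6X.lean` and `Rows/C2aL157A6XAB.lean`: `BS04Package` (CITED), `DataComplete …` (COMPUTED level files), `EisPackage` (CITED) and `Refines` (COMPUTED) for the M6 orbits discharged in the kernel, and the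
rows' per-orbit exclusions for BOTH family predicates (`famB`, `famAB`) as universally quantified hypotheses (CITED: the census
row's certificates). Conclusion = p1's census predicate (`Rows/Statements.lean`), all four coprime coefficient
distributions `A·B = 2^a·157^m`, reduced exponents `a < n`, `m < n` (RULING H1). GENERATED by p-lean g2 gen/make_rows.py
(after plean/make_cell_bridges.py).
-/

namespace Summit.Ventures.AbcSig

/-- Cell `C2aL157A6` (M6 orbits discharged in the kernel): `Rows.C2aCellRed 157 (fun a => 6 ≤ a) ∅` under the rows' hypotheses. -/
theorem xcell_C2aL157A6S (M : NewformModel) (hP : M.BS04Package)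
    (hE : M.EisPackage)
    (hD157 : M.DataComplete 157 level157Orbits)
    (hD314 : M.DataComplete 314 level314Orbits)
    (hR_orbit_157_2 : M.Refines 157 orbit_157_2 m6X_157_2)
    (hR_orbit_314_3 : M.Refines 314 orbit_314_3 m6X_314_3)
    (hRB_orbit_314_2 : ∀ f : M.Form 314, M.Matches f orbit_314_2 → M.Matches f rb_314_2) :
    Rows.C2aCellRed 157 (fun a => 6 ≤ a) ∅ :=
  C2aCellRed_of_rows 157 (by norm_num) (by norm_num) _ _
    (fun n hn h11 hnℓ _ a m ha han hm hmn x y z h1 h2 =>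
      xrow_C2aL157A6S M hP hE hD157 hD314 hR_orbit_157_2 hR_orbit_314_3 n hn h11 hnℓ a m ha hm han hmn hRB_orbit_314_2 x y z h1 h2)
    (fun n hn h11 hnℓ _ a m ha han hm hmn x y z h1 h2 =>
      xrow_C2aL157A6SAB M hP hE hD157 hD314 hR_orbit_157_2 hR_orbit_314_3 n hn h11 hnℓ a m ha hm han hmn hRB_orbit_314_2 x y z h1 h2)

end Summit.Ventures.AbcSig
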